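import Mathlib
import Literature.RingTheory.MvPolynomial.LinearFormsCoeff
import Summits.ValiantsHypothesis.ValiantsHypothesis.Theorems.RigidityForcesSymmetryRankRigidMinimalReprLaplaceFiveStarLemmaKEndgame
import Summits.ValiantsHypothesis.ValiantsHypothesis.Theorems.RigidityForcesSymmetryRankRigidMinimalReprLaplaceFiveStarLemmaKLinearDivisor

/-!
# ValiantsHypothesis / RigidityForcesSymmetry — crux `LaplaceOptimalFive` (stmt-ValiantsHypothesis-24813), crux idea
`young-shadow` (K1) on the star: **«SAME λ» — TWO PROPER T1 PRESENTATIONS OF THE COMMON SLACK HAVE PARALLEL LINEAR DIVISORS**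
(memo `NOTE-p4g15-24813-K1-star.md` §5 proof of the theorem «all three are T1 with the SAME ℓ (the unique linear form dividing E)»,
§9 «uniqueness lemma = E ≠ 0 ∧ E = ℓ·B = ℓ'·B' ⟹ λ ∥ λ'»; memo `NOTE-p4g16-24813-LemmaK-kernel.md` r2 §4 (iii))

By ✓ `t1_slack_entry`, a proper T1 two-term split presents the common slack as `40·E_{ab} = 15a₂·L·G_{ab}` with
`G_{ab} = 2L²Q_{ab} − L(λ_a∂_bQ + λ_b∂_aQ) + 2λ_aλ_bQ`, `L = Σ λ_z X_z`, `Q_{ab} = U_{ab}` the matrix of the non-square generator.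
If a second split presents the same `E` with linear form `L' = Σ λ'_z X_z`, then `L' ∣ L·G_{ab}` for every `(a,b)`.

* `contract_G` — for `μ ⊥ λ`: `Σ_{a,b} μ_aμ_b·(L·G_{ab}) = 2·q_U(μ)·L³`, `q_U(μ) = Σ μ_aμ_b U_{ab}` (the bi-form
  `Σ x_ax_b G_{ab} = 2·Q(L(y)x − L(x)y)` at `x = μ`).  `Q` is an ARBITRARY polynomial here.
* `same_linear_divisor` — `λ_{z₀} ≠ 0`, `U` symmetric, `L' ∣ L·G_{ab}` for all `(a,b)` ⟹ `λ' = t·λ` for a constant `t`, OR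
  `U = λmᵀ + mλᵀ` (DEGENERATE: `q_U` vanishes on `ker λ`).  Proof: `L'` prime (or zero); `L' ∣ L` gives parallel linear forms
  (✓ `eq_C_mul_of_dvd_linear`); otherwise `L' ∣ G_{ab}`, so `L' ∣ 2q_U(μ)L³` forces `q_U(μ) = 0` for every `μ ⊥ λ`; polarising on
  the basis `λ_{z₀}e_z − λ_z e_{z₀}` of `ker λ` yields `m`.
* `G_eq_zero_of_degenerate` — if `U = λmᵀ + mλᵀ` and `Q = Σ U_{ij}X_iX_j` then every `G_{ab} = 0`: a degenerate T1 split has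
  slack `E = 0` (and then `rank(Hess m + 4E) = 10` directly, ✓ `offDiag_entries_independent`).

No definitions, no `sorry`.  Honest framing: (L3) brick «same λ», closes nothing; the dictionary, the rebasing and the final count
remain; K1-on-the-star PAPER PASS, not kernel; `LaplaceOptimalFive` OPEN · CONTESTED 72/120; `VP ≠ VNP` NOT proved.
-/

set_option linter.dupNamespace false

namespace Summit.ValiantsHypothesis.ValiantsHypothesis.Theorems.RigidityForcesSymmetryRankRigidMinimalRepr

namespace LaplaceFiveStar

open Finset MvPolynomial

/-- `Σ_a (if a = z then 1 else 0)·f a = f z`. [folklore] -/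
theorem sum_ite_one_mul (z : Fin 5) (f : Fin 5 → ℂ) :
    ∑ a : Fin 5, (if a = z then (1 : ℂ) else 0) * f a = f z := by
  rw [Finset.sum_eq_single z]
  · rw [if_pos rfl, one_mul]
  · intro b _ hb
    rw [if_neg hb, zero_mul]
  · intro h
    exact absurd (Finset.mem_univ z) h

/-- **Contraction of the T1 slack shape with a vector `μ ⊥ λ`.**  With `G_{ab} = 2L²U_{ab} − L(λ_a∂_bQ + λ_b∂_aQ) + 2λ_aλ_bQ`:
`Σ_{a,b} μ_aμ_b (L·G_{ab}) = 2(Σ μ_aμ_bU_{ab})·L³` whenever `Σ μ_aλ_a = 0` (`Q` arbitrary). [folklore] -/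
theorem contract_G (lam μ : Fin 5 → ℂ) (hμ : ∑ a : Fin 5, μ a * lam a = 0) (U : Fin 5 → Fin 5 → ℂ)
    (Q : MvPolynomial (Fin 5) ℂ) :
    let L : MvPolynomial (Fin 5) ℂ := ∑ z : Fin 5, lam z • (X z : MvPolynomial (Fin 5) ℂ)
    ∑ a : Fin 5, ∑ b : Fin 5, C (μ a * μ b) * (L * (2 * L ^ 2 * C (U a b)
        - L * (C (lam a) * pderiv b Q + C (lam b) * pderiv a Q) + 2 * C (lam a * lam b) * Q))
      = C (2 * ∑ a : Fin 5, ∑ b : Fin 5, μ a * μ b * U a b) * L ^ 3 := by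
  intro L
  set D : MvPolynomial (Fin 5) ℂ := ∑ a : Fin 5, C (μ a) * pderiv a Q with hD
  have hμC : ∑ a : Fin 5, C (μ a * lam a) = (0 : MvPolynomial (Fin 5) ℂ) := by
    rw [← map_sum, hμ, C_0]
  -- inner sum over `b`, for fixed `a`
  have inner : ∀ a : Fin 5, ∑ b : Fin 5, C (μ a * μ b) * (L * (2 * L ^ 2 * C (U a b)
      - L * (C (lam a) * pderiv b Q + C (lam b) * pderiv a Q) + 2 * C (lam a * lam b) * Q))
      = 2 * L ^ 3 * C (μ a) * C (∑ b : Fin 5, μ b * U a b) - L ^ 2 * C (μ a * lam a) * D := by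
    intro a
    have hterm : ∀ b : Fin 5, C (μ a * μ b) * (L * (2 * L ^ 2 * C (U a b)
        - L * (C (lam a) * pderiv b Q + C (lam b) * pderiv a Q) + 2 * C (lam a * lam b) * Q))
        = 2 * L ^ 3 * C (μ a) * C (μ b * U a b) - L ^ 2 * C (μ a * lam a) * (C (μ b) * pderiv b Q)
          - L ^ 2 * C (μ a) * pderiv a Q * C (μ b * lam b) + 2 * L * C (μ a * lam a) * Q * C (μ b * lam b) := by
      intro b
      simp only [map_mul]
      ring
    rw [Finset.sum_congr rfl fun b _ => hterm b, Finset.sum_add_distrib, Finset.sum_sub_distrib,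
      Finset.sum_sub_distrib, ← Finset.mul_sum, ← Finset.mul_sum, ← Finset.mul_sum, ← Finset.mul_sum, ← map_sum, hμC,
      mul_zero, mul_zero, sub_zero, add_zero, hD]
  rw [Finset.sum_congr rfl fun a _ => inner a, Finset.sum_sub_distrib]
  have h1 : ∑ a : Fin 5, 2 * L ^ 3 * C (μ a) * C (∑ b : Fin 5, μ b * U a b)
      = C (2 * ∑ a : Fin 5, ∑ b : Fin 5, μ a * μ b * U a b) * L ^ 3 := by
    rw [map_mul, map_sum, Finset.mul_sum, Finset.sum_mul]
    refine Finset.sum_congr rfl fun a _ => ?_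
    rw [map_sum, map_sum, Finset.mul_sum, Finset.mul_sum, Finset.sum_mul]
    refine Finset.sum_congr rfl fun b _ => ?_
    simp only [map_mul, map_ofNat]
    ring
  have h2 : ∑ a : Fin 5, L ^ 2 * C (μ a * lam a) * D = 0 := by
    have : ∀ a : Fin 5, L ^ 2 * C (μ a * lam a) * D = L ^ 2 * D * C (μ a * lam a) := fun a => by ring
    rw [Finset.sum_congr rfl fun a _ => this a, ← Finset.mul_sum, hμC, mul_zero]
  rw [h1, h2, sub_zero]

/-- **«Same λ».**  Let `λ_{z₀} ≠ 0`, `U` symmetric, `L = Σ λ_zX_z`, `L' = Σ λ'_zX_z`, and suppose `L' ∣ L·G_{ab}` for all `(a,b)`,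
`G_{ab} = 2L²U_{ab} − L(λ_a∂_bQ + λ_b∂_aQ) + 2λ_aλ_bQ` (`Q` arbitrary).  Then `λ' = t·λ` for a constant `t`, or `U = λmᵀ + mλᵀ`
(the quadratic form of `U` vanishes on `ker λ`); memo `NOTE-p4g15-24813-K1-star.md` §5/§9 «uniqueness of ℓ». [folklore] -/
theorem same_linear_divisor (lam lam' : Fin 5 → ℂ) (z₀ : Fin 5) (hz₀ : lam z₀ ≠ 0) (U : Fin 5 → Fin 5 → ℂ)
    (hU : ∀ a b : Fin 5, U a b = U b a) (Q : MvPolynomial (Fin 5) ℂ)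
    (hdiv : ∀ a b : Fin 5, (∑ z : Fin 5, lam' z • (X z : MvPolynomial (Fin 5) ℂ)) ∣
      (∑ z : Fin 5, lam z • (X z : MvPolynomial (Fin 5) ℂ)) *
        (2 * (∑ z : Fin 5, lam z • (X z : MvPolynomial (Fin 5) ℂ)) ^ 2 * C (U a b)
          - (∑ z : Fin 5, lam z • (X z : MvPolynomial (Fin 5) ℂ)) * (C (lam a) * pderiv b Q + C (lam b) * pderiv a Q)
          + 2 * C (lam a * lam b) * Q)) :
    (∃ t : ℂ, ∀ z : Fin 5, lam' z = t * lam z) ∨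
      (∃ m : Fin 5 → ℂ, ∀ a b : Fin 5, U a b = lam a * m b + m a * lam b) := by
  classical
  set L : MvPolynomial (Fin 5) ℂ := ∑ z : Fin 5, lam z • (X z : MvPolynomial (Fin 5) ℂ) with hL
  set L' : MvPolynomial (Fin 5) ℂ := ∑ z : Fin 5, lam' z • (X z : MvPolynomial (Fin 5) ℂ) with hL'
  by_cases hlam' : lam' = 0
  · exact Or.inl ⟨0, fun z => by rw [hlam', Pi.zero_apply, zero_mul]⟩
  have hL'0 : L' ≠ 0 := fun h => hlam' ((Literature.RingTheory.MvPolynomial.sum_smul_X_eq_zero_iff lam').mp h)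
  have hL'1 : L'.IsHomogeneous 1 := Literature.RingTheory.MvPolynomial.isHomogeneous_one_sum_smul_X lam'
  have hL1 : L.IsHomogeneous 1 := Literature.RingTheory.MvPolynomial.isHomogeneous_one_sum_smul_X lam
  have hL'prime : Prime L' := prime_of_totalDegree_eq_one (hL'1.totalDegree hL'0)
  by_cases hpar : L' ∣ L
  · -- parallel linear forms
    left
    obtain ⟨κ, hκ⟩ := eq_C_mul_of_dvd_linear hL'1 hL'0 hL1 hpar
    have hcoef : ∀ z : Fin 5, lam z = κ * lam' z := by
      intro z
      have h1 := congr_arg (coeff (Finsupp.single z 1)) hκ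
      rw [hL, hL', coeff_C_mul] at h1
      simpa only [Literature.RingTheory.MvPolynomial.coeff_single_one_sum_smul_X] using h1
    have hκ0 : κ ≠ 0 := by
      intro h0
      exact hz₀ (by rw [hcoef z₀, h0, zero_mul])
    exact ⟨κ⁻¹, fun z => by rw [hcoef z, ← mul_assoc, inv_mul_cancel₀ hκ0, one_mul]⟩
  · -- `L' ∤ L`: `L'` divides every `G_{ab}`, hence `q_U` vanishes on `ker λ`
    right
    have hq : ∀ μ : Fin 5 → ℂ, ∑ a : Fin 5, μ a * lam a = 0 → ∑ a : Fin 5, ∑ b : Fin 5, μ a * μ b * U a b = 0 := by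
      intro μ hμ
      have hsum : L' ∣ C (2 * ∑ a : Fin 5, ∑ b : Fin 5, μ a * μ b * U a b) * L ^ 3 := by
        rw [← contract_G lam μ hμ U Q]
        exact Finset.dvd_sum fun a _ => Finset.dvd_sum fun b _ => Dvd.dvd.mul_left (hdiv a b) _
      by_contra hne
      rcases hL'prime.dvd_or_dvd hsum with h | h
      · have hunit : IsUnit (C (2 * ∑ a : Fin 5, ∑ b : Fin 5, μ a * μ b * U a b) : MvPolynomial (Fin 5) ℂ) :=
          (isUnit_iff_ne_zero.mpr (mul_ne_zero two_ne_zero hne)).map C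
        exact hL'prime.not_unit (isUnit_of_dvd_unit h hunit)
      · exact hpar (hL'prime.dvd_of_dvd_pow h)
    -- polarisation on the basis `v_z = λ_{z₀} e_z − λ_z e_{z₀}` of `ker λ`
    let v : Fin 5 → Fin 5 → ℂ := fun z a => lam z₀ * (if a = z then 1 else 0) - lam z * (if a = z₀ then 1 else 0)
    have hv : ∀ z : Fin 5, ∑ a : Fin 5, v z a * lam a = 0 := by
      intro z
      simp only [v, sub_mul, mul_assoc, Finset.sum_sub_distrib, ← Finset.mul_sum, sum_ite_one_mul]
      ring
    have hUv : ∀ (w : Fin 5) (a : Fin 5), ∑ b : Fin 5, v w b * U a b = lam z₀ * U a w - lam w * U a z₀ := by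
      intro w a
      simp only [v, sub_mul, mul_assoc, Finset.sum_sub_distrib, ← Finset.mul_sum, sum_ite_one_mul]
    have hB : ∀ z w : Fin 5, ∑ a : Fin 5, ∑ b : Fin 5, v z a * v w b * U a b
        = lam z₀ * (lam z₀ * U z w - lam w * U z z₀) - lam z * (lam z₀ * U z₀ w - lam w * U z₀ z₀) := by
      intro z w
      have : ∀ a : Fin 5, ∑ b : Fin 5, v z a * v w b * U a b = v z a * (lam z₀ * U a w - lam w * U a z₀) := by
        intro a
        rw [← hUv w a, Finset.mul_sum]
        exact Finset.sum_congr rfl fun b _ => by ring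
      rw [Finset.sum_congr rfl fun a _ => this a]
      simp only [v, sub_mul, mul_assoc, Finset.sum_sub_distrib, ← Finset.mul_sum, sum_ite_one_mul]
    have hpol : ∀ z w : Fin 5, ∑ a : Fin 5, ∑ b : Fin 5, v z a * v w b * U a b = 0 := by
      intro z w
      have h1 := hq (v z) (hv z)
      have h2 := hq (v w) (hv w)
      have h3 := hq (fun a => v z a + v w a) (by
        simp only [add_mul, Finset.sum_add_distrib, hv, add_zero])
      have hsymm : ∑ a : Fin 5, ∑ b : Fin 5, v w a * v z b * U a b = ∑ a : Fin 5, ∑ b : Fin 5, v z a * v w b * U a b := by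
        rw [Finset.sum_comm]
        exact Finset.sum_congr rfl fun a _ => Finset.sum_congr rfl fun b _ => by rw [hU b a]; ring
      have hexp : ∑ a : Fin 5, ∑ b : Fin 5, (v z a + v w a) * (v z b + v w b) * U a b
          = ∑ a : Fin 5, ∑ b : Fin 5, v z a * v z b * U a b + ∑ a : Fin 5, ∑ b : Fin 5, v w a * v w b * U a b
            + 2 * ∑ a : Fin 5, ∑ b : Fin 5, v z a * v w b * U a b := by
        rw [two_mul]
        nth_rewrite 2 [← hsymm]
        simp only [← Finset.sum_add_distrib]
        exact Finset.sum_congr rfl fun a _ => Finset.sum_congr rfl fun b _ => by ring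
      have h3' : ∑ a : Fin 5, ∑ b : Fin 5, (v z a + v w a) * (v z b + v w b) * U a b = 0 := h3
      rw [hexp, h1, h2, zero_add, zero_add] at h3'
      exact (mul_eq_zero.mp h3').resolve_left two_ne_zero
    refine ⟨fun b => U z₀ b / lam z₀ - U z₀ z₀ * lam b / (2 * lam z₀ ^ 2), fun a b => ?_⟩
    have h := hpol a b
    rw [hB] at h
    field_simp
    rw [hU z₀ a]
    linear_combination 2 * h

/-- **A degenerate T1 split has zero slack.**  If `U = λmᵀ + mλᵀ` and `Q = Σ U_{ij}X_iX_j` (`= 2LM`), then every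
`G_{ab} = 2L²U_{ab} − L(λ_a∂_bQ + λ_b∂_aQ) + 2λ_aλ_bQ` vanishes. [folklore] -/
theorem G_eq_zero_of_degenerate (lam m : Fin 5 → ℂ) (U : Fin 5 → Fin 5 → ℂ)
    (hUm : ∀ a b : Fin 5, U a b = lam a * m b + m a * lam b) (a b : Fin 5) :
    let L : MvPolynomial (Fin 5) ℂ := ∑ z : Fin 5, lam z • (X z : MvPolynomial (Fin 5) ℂ)
    let Q : MvPolynomial (Fin 5) ℂ := ∑ i : Fin 5, ∑ j : Fin 5, C (U i j) * X i * X j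
    2 * L ^ 2 * C (U a b) - L * (C (lam a) * pderiv b Q + C (lam b) * pderiv a Q) + 2 * C (lam a * lam b) * Q = 0 := by
  classical
  intro L Q
  set M : MvPolynomial (Fin 5) ℂ := ∑ z : Fin 5, m z • (X z : MvPolynomial (Fin 5) ℂ) with hM
  have hQ : Q = 2 * L * M := by
    have h1 : L * M = ∑ i : Fin 5, ∑ j : Fin 5, C (lam i * m j) * X i * X j := by
      show (∑ z : Fin 5, lam z • (X z : MvPolynomial (Fin 5) ℂ)) * (∑ z : Fin 5, m z • (X z : MvPolynomial (Fin 5) ℂ)) = _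
      rw [Finset.sum_mul_sum]
      refine Finset.sum_congr rfl fun i _ => Finset.sum_congr rfl fun j _ => ?_
      rw [smul_eq_C_mul, smul_eq_C_mul, map_mul]
      ring
    have h2 : M * L = ∑ i : Fin 5, ∑ j : Fin 5, C (m i * lam j) * X i * X j := by
      show (∑ z : Fin 5, m z • (X z : MvPolynomial (Fin 5) ℂ)) * (∑ z : Fin 5, lam z • (X z : MvPolynomial (Fin 5) ℂ)) = _
      rw [Finset.sum_mul_sum]
      refine Finset.sum_congr rfl fun i _ => Finset.sum_congr rfl fun j _ => ?_
      rw [smul_eq_C_mul, smul_eq_C_mul, map_mul]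
      ring
    have h3 : Q = L * M + M * L := by
      rw [h1, h2, ← Finset.sum_add_distrib]
      refine Finset.sum_congr rfl fun i _ => ?_
      rw [← Finset.sum_add_distrib]
      refine Finset.sum_congr rfl fun j _ => ?_
      rw [hUm i j, map_add]
      ring
    rw [h3]
    ring
  have hdL : ∀ c : Fin 5, pderiv c L = C (lam c) := fun c => pderiv_sum_smul_X lam c
  have hdM : ∀ c : Fin 5, pderiv c M = C (m c) := fun c => by rw [hM]; exact pderiv_sum_smul_X m c
  have hdQ : ∀ c : Fin 5, pderiv c Q = 2 * (C (lam c) * M + L * C (m c)) := by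
    intro c
    rw [hQ]
    simp only [Derivation.leibniz, smul_eq_mul, hdL, hdM, mul_comm]
    have h2 : pderiv c (2 : MvPolynomial (Fin 5) ℂ) = 0 := by
      rw [show (2 : MvPolynomial (Fin 5) ℂ) = C 2 by rw [map_ofNat], pderiv_C]
    rw [h2]
    ring
  rw [hdQ a, hdQ b, hQ, hUm a b, map_add, map_mul, map_mul, map_mul]
  ring
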